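import Literature.Geometry.Manifold.InverseFunctionTheorem
import Mathlib.Geometry.Manifold.Instances.Sphere
import Mathlib.Analysis.SpecialFunctions.Complex.Circle
import Mathlib.Geometry.Manifold.ContMDiffMFDeriv
import Mathlib.Geometry.Manifold.MFDeriv.SpecificFunctions
import HarnessLib

/-!
# A `2π`-periodic global flow is a smooth circle action

General differential topology (topic `Geometry/Manifold`). The tree's package on smooth circle
actions (`FreeCircleAction.lean`, `FreeCircleFlowBox.lean`, `FreeCircleQuotient*.lean`,
`CircleActionOrbitAverage.lean`, `CircleQuotientLift.lean`) takes an action in the form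
`θ : Circle → M → M`, `θ 1 = id`, `θ (a * b) = θ a ∘ θ b`, jointly `C^∞` for the model
`(𝓡 1).prod (𝓡 k)`. Periodic symmetries usually ARISE as flows: a complete vector field all of
whose integral curves are `2π`-periodic (e.g. an axisymmetric Killing field of a space-time,
`Literature.Geometry.Lorentzian.LorentzianMetric.IsAxisymmetricKilling`; the generator of a
Hamiltonian circle action) has a `C^∞` global flow `ψ : ℝ × M → M` with `ψ₀ = id`, the group law,
and `ψ_{t + 2π} = ψ_t`. This file performs the (folklore) descent `ℝ → ℝ/2πℤ ≅ S¹`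
(Lee 2012, Example 21.1 (c)/(d) with Thm. 21.13 and Prop. 7.24 ff.: a smooth `ℝ`-action whose
kernel contains `2πℤ` induces a smooth action of `ℝ/2πℤ = S¹`):

* `flowCircleAction ψ : Circle → M → M`, `a ↦ ψ_{arg a}` — **the circle action of a periodic flow**;
* `flowCircleAction_exp` — `flowCircleAction ψ (exp t) = ψ_t` (well defined by periodicity);
  `flowCircleAction_one`, `flowCircleAction_mul` — it is an action;
* `isLocalDiffeomorphAt_circleExp` — `exp : ℝ → S¹` is a local diffeomorphism (inverse function
  theorem of `InverseFunctionTheorem.lean`, its differential being injective);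
* **`contMDiff_flowCircleAction`** — the action is jointly `C^∞`: near `(a₀, x₀)` it is
  `ψ ∘ (σ × id)` for a smooth local section `σ` of `exp` at `a₀`.

Everything is proved; the only definition is `flowCircleAction`; no named facts (D-0026).

## References

* J. M. Lee, *Introduction to Smooth Manifolds*, 2nd ed., GTM 218, Springer (2012), Thm. 4.5,
  Example 7.3/21.1, Thm. 9.12, Thm. 21.13. [LeeSmoothManifolds2013]
-/

noncomputable section

open Set Function Complex
open scoped Manifold ContDiff Topology Real

namespace Literature.Geometry.Manifold

/-! ### `exp : ℝ → S¹` is a local diffeomorphism -/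

section CircleExp

/-- The inclusion `S¹ ⊆ ℂ` composed with `exp` is `t ↦ e^{it}`, with derivative `i e^{it}`
(as in `CyclicCoverLevelSubmersion.lean`, reproved here to keep the imports light). [folklore] -/
private theorem hasDerivAt_coe_circleExp_aux (t : ℝ) :
    HasDerivAt (fun s : ℝ ↦ ((Circle.exp s : Circle) : ℂ))
      (Complex.exp (t * Complex.I) * Complex.I) t := by
  have h : (fun s : ℝ ↦ ((Circle.exp s : Circle) : ℂ)) = fun s : ℝ ↦ Complex.exp (s * Complex.I) :=
    funext fun s ↦ Circle.coe_exp s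
  rw [h]
  have h1 : HasDerivAt (fun s : ℝ ↦ (s : ℂ) * Complex.I) Complex.I t := by
    simpa using (Complex.ofRealCLM.hasDerivAt (x := t)).mul_const Complex.I
  exact (Complex.hasDerivAt_exp _).comp t h1

/-- The differential of `exp : ℝ → S¹` is injective (as in `CyclicCoverLevelSubmersion.lean`,
`injective_mfderiv_circleExp`, reproved here to keep the imports light). [folklore] -/
private theorem injective_mfderiv_circleExp_aux (t : ℝ) :
    Injective (mfderiv 𝓘(ℝ, ℝ) (𝓡 1) Circle.exp t) := by
  haveI : Fact (Module.finrank ℝ ℂ = 1 + 1) := finrank_real_complex_fact'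
  have hexp : MDifferentiableAt 𝓘(ℝ, ℝ) (𝓡 1) Circle.exp t :=
    (contMDiff_circleExp (m := 1)).mdifferentiableAt one_ne_zero
  have hcoe : MDifferentiableAt (𝓡 1) 𝓘(ℝ, ℂ) (fun z : Circle ↦ (z : ℂ)) (Circle.exp t) :=
    (contMDiff_coe_sphere (m := 1) (n := 1)).mdifferentiableAt one_ne_zero
  have hcomp : mfderiv 𝓘(ℝ, ℝ) 𝓘(ℝ, ℂ) (fun s : ℝ ↦ ((Circle.exp s : Circle) : ℂ)) t =
      (mfderiv (𝓡 1) 𝓘(ℝ, ℂ) (fun z : Circle ↦ (z : ℂ)) (Circle.exp t)).comp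
        (mfderiv 𝓘(ℝ, ℝ) (𝓡 1) Circle.exp t) :=
    mfderiv_comp t hcoe hexp
  have hval : ∀ c : ℝ, mfderiv 𝓘(ℝ, ℝ) 𝓘(ℝ, ℂ) (fun s : ℝ ↦ ((Circle.exp s : Circle) : ℂ)) t c =
      (c : ℂ) * (Complex.exp (t * Complex.I) * Complex.I) := fun c ↦ by
    rw [mfderiv_eq_fderiv, (hasDerivAt_coe_circleExp_aux t).hasFDerivAt.fderiv]
    show c • (Complex.exp (t * Complex.I) * Complex.I) = (c : ℂ) * _
    exact Complex.real_smul
  intro a b hab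
  have h := congrArg (⇑(mfderiv (𝓡 1) 𝓘(ℝ, ℂ) (fun z : Circle ↦ (z : ℂ)) (Circle.exp t))) hab
  have ha := hval a
  have hb := hval b
  rw [hcomp, ContinuousLinearMap.comp_apply] at ha hb
  rw [ha, hb] at h
  have hne : Complex.exp (t * Complex.I) * Complex.I ≠ 0 :=
    mul_ne_zero (Complex.exp_ne_zero _) Complex.I_ne_zero
  exact_mod_cast mul_right_cancel₀ hne h

/-- **`exp : ℝ → S¹` is a `C^∞` local diffeomorphism at every point**: its differential is an
injective linear map `ℝ → T_{e^{it}} S¹ ≅ ℝ¹`, hence an isomorphism, and the inverse function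
theorem for manifolds (`isLocalDiffeomorphAt_of_mfderiv`, Lee 2012, Thm. 4.5) applies.
Lee 2012, Example 4.35 / Prop. 4.40 (`ε(t) = e^{2πit}` is a smooth covering map, hence a local
diffeomorphism). [cite: LeeSmoothManifolds2013, Thm. 4.5 and Prop. 4.40] -/
theorem isLocalDiffeomorphAt_circleExp (t : ℝ) :
    IsLocalDiffeomorphAt 𝓘(ℝ, ℝ) (𝓡 1) ∞ Circle.exp t := by
  set L : ℝ →L[ℝ] EuclideanSpace ℝ (Fin 1) := mfderiv 𝓘(ℝ, ℝ) (𝓡 1) Circle.exp t with hL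
  have hinj : Injective L := injective_mfderiv_circleExp_aux t
  have hdim : Module.finrank ℝ ℝ = Module.finrank ℝ (EuclideanSpace ℝ (Fin 1)) := by
    rw [Module.finrank_self, finrank_euclideanSpace_fin]
  have hsurj : Surjective L :=
    (LinearMap.injective_iff_surjective_of_finrank_eq_finrank hdim).1 hinj
  let f' : ℝ ≃L[ℝ] EuclideanSpace ℝ (Fin 1) :=
    (LinearEquiv.ofBijective (L : ℝ →ₗ[ℝ] EuclideanSpace ℝ (Fin 1))
      ⟨hinj, hsurj⟩).toContinuousLinearEquiv
  refine isLocalDiffeomorphAt_of_mfderiv (I := 𝓘(ℝ, ℝ)) (J := 𝓡 1) (n := ∞) (by simp)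
    isOpen_univ (mem_univ t) contMDiff_circleExp.contMDiffOn f' ?_
  exact ContinuousLinearMap.ext fun c ↦ rfl

end CircleExp

/-! ### The circle action of a `2π`-periodic flow -/

section Flow

variable {M : Type*}

/-- **The circle action of a (`2π`-periodic) flow**: `a ↦ ψ_{arg a}`, i.e. `e^{it} ↦ ψ_t`
(`flowCircleAction_exp`, well defined when `ψ_{t+2π} = ψ_t`). Lee 2012, Example 21.1 and
Thm. 21.13 (actions of `ℝ/Γ` induced by `ℝ`-actions trivial on `Γ`). [cite: LeeSmoothManifolds2013, Example 21.1] -/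
def flowCircleAction (ψ : ℝ × M → M) : Circle → M → M := fun a x ↦ ψ (arg (a : ℂ), x)

variable {ψ : ℝ × M → M}

/-- Unfolding lemma. [folklore] -/
theorem flowCircleAction_apply (a : Circle) (x : M) :
    flowCircleAction ψ a x = ψ (arg (a : ℂ), x) :=
  rfl

/-- A `2π`-periodic flow is `2πm`-periodic for every integer `m`. [folklore] -/
theorem flow_apply_add_int_mul_two_pi (hper : ∀ t x, ψ (t + 2 * π, x) = ψ (t, x)) (t : ℝ)
    (m : ℤ) (x : M) : ψ (t + m * (2 * π), x) = ψ (t, x) := by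
  have h : Function.Periodic (fun s ↦ ψ (s, x)) (2 * π) := fun s ↦ hper s x
  exact h.int_mul m t

/-- **`flowCircleAction ψ (exp t) = ψ_t`**: the action of `e^{it}` is the time-`t` flow map —
`arg (e^{it}) = t - 2πm` for an integer `m`, and the flow is `2π`-periodic.
[cite: LeeSmoothManifolds2013, Example 21.1] -/
theorem flowCircleAction_exp (hper : ∀ t x, ψ (t + 2 * π, x) = ψ (t, x)) (t : ℝ) (x : M) :
    flowCircleAction ψ (Circle.exp t) x = ψ (t, x) := by
  rw [flowCircleAction_apply]
  have h1 : Circle.exp (arg (Circle.exp t : ℂ) - t) = 1 := by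
    rw [Circle.exp_sub, Circle.exp_arg, div_self']
  obtain ⟨m, hm⟩ := Circle.exp_eq_one.1 h1
  have harg : arg (Circle.exp t : ℂ) = t + m * (2 * π) := by linarith
  rw [harg, flow_apply_add_int_mul_two_pi hper]

/-- The identity acts trivially (`arg 1 = 0`, `ψ₀ = id`). [folklore] -/
theorem flowCircleAction_one (hψ0 : ∀ x, ψ (0, x) = x) (x : M) : flowCircleAction ψ 1 x = x := by
  rw [flowCircleAction_apply, Circle.coe_one, Complex.arg_one, hψ0]

/-- **The group law**: `flowCircleAction ψ (a * b) = flowCircleAction ψ a ∘ flowCircleAction ψ b`,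
from the group law of the flow (`a = e^{is}`, `b = e^{it}`, `ab = e^{i(s+t)}`, `ψ_{s+t} = ψ_s ∘ ψ_t`).
[cite: LeeSmoothManifolds2013, Example 21.1] -/
theorem flowCircleAction_mul (hψadd : ∀ s t x, ψ (s, ψ (t, x)) = ψ (s + t, x))
    (hper : ∀ t x, ψ (t + 2 * π, x) = ψ (t, x)) (a b : Circle) (x : M) :
    flowCircleAction ψ (a * b) x = flowCircleAction ψ a (flowCircleAction ψ b x) := by
  obtain ⟨s, rfl⟩ : ∃ s : ℝ, Circle.exp s = a := ⟨_, Circle.exp_arg a⟩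
  obtain ⟨t, rfl⟩ : ∃ t : ℝ, Circle.exp t = b := ⟨_, Circle.exp_arg b⟩
  rw [← Circle.exp_add, flowCircleAction_exp hper, flowCircleAction_exp hper,
    flowCircleAction_exp hper, hψadd]

/-- The orbit curves of the action are the flow lines: `t ↦ flowCircleAction ψ (exp t) x = ψ_t x`.
[folklore] -/
theorem flowCircleAction_exp_comp (hper : ∀ t x, ψ (t + 2 * π, x) = ψ (t, x)) (x : M) :
    (fun t : ℝ ↦ flowCircleAction ψ (Circle.exp t) x) = fun t ↦ ψ (t, x) :=
  funext fun t ↦ flowCircleAction_exp hper t x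

/-- A point is fixed by the whole circle iff it is fixed by the flow. [folklore] -/
theorem flowCircleAction_eq_self_iff (hper : ∀ t x, ψ (t + 2 * π, x) = ψ (t, x)) (x : M) :
    (∀ a, flowCircleAction ψ a x = x) ↔ ∀ t, ψ (t, x) = x := by
  constructor
  · intro h t
    rw [← flowCircleAction_exp hper t x]
    exact h _
  · intro h a
    rw [flowCircleAction_apply]
    exact h _

end Flow

section Smooth

variable {k : ℕ} {M : Type*} [TopologicalSpace M] [ChartedSpace (EuclideanSpace ℝ (Fin k)) M]
  {ψ : ℝ × M → M}

/-- **The circle action of a smooth `2π`-periodic flow is jointly `C^∞`.** Near `(a₀, x₀)`, with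
`σ` a smooth local section of `exp` at `a₀` (`isLocalDiffeomorphAt_circleExp`), the action is
`(a, x) ↦ ψ(σ a, x)` (`flowCircleAction_exp` with `a = exp (σ a)`), a composite of smooth maps.
Lee 2012, Thm. 21.13 with Example 21.1 (smoothness of the induced `ℝ/2πℤ`-action; Thm. 4.29/4.30:
characteristic property of surjective submersions). [cite: LeeSmoothManifolds2013, Thm. 4.30 and Example 21.1] -/
theorem contMDiff_flowCircleAction (hψ : ContMDiff (𝓘(ℝ, ℝ).prod (𝓡 k)) (𝓡 k) ∞ ψ)
    (hper : ∀ t x, ψ (t + 2 * π, x) = ψ (t, x)) :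
    ContMDiff ((𝓡 1).prod (𝓡 k)) (𝓡 k) ∞ (fun p : Circle × M ↦ flowCircleAction ψ p.1 p.2) := by
  rintro ⟨a₀, x₀⟩
  have hloc : IsLocalDiffeomorphAt 𝓘(ℝ, ℝ) (𝓡 1) ∞ Circle.exp (arg (a₀ : ℂ)) :=
    isLocalDiffeomorphAt_circleExp _
  set σ := hloc.localInverse with hσdef
  have ha₀ : a₀ ∈ σ.source := by
    have h := hloc.localInverse_mem_source
    rwa [Circle.exp_arg] at h
  have hσ : ContMDiffOn (𝓡 1) 𝓘(ℝ, ℝ) ∞ σ σ.source := hloc.contmdiffOn_localInverse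
  have hright : ∀ a ∈ σ.source, Circle.exp (σ a) = a := fun a ha ↦ hloc.localInverse_right_inv ha
  have hopen : IsOpen (σ.source ×ˢ (univ : Set M)) := hloc.localInverse_open_source.prod isOpen_univ
  have hsmooth : ContMDiffOn ((𝓡 1).prod (𝓡 k)) (𝓡 k) ∞ (fun p : Circle × M ↦ ψ (σ p.1, p.2))
      (σ.source ×ˢ (univ : Set M)) :=
    hψ.comp_contMDiffOn ((hσ.comp contMDiffOn_fst fun p hp ↦ hp.1).prodMk contMDiffOn_snd)
  have heq : ∀ p ∈ σ.source ×ˢ (univ : Set M),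
      (fun p : Circle × M ↦ flowCircleAction ψ p.1 p.2) p = ψ (σ p.1, p.2) := by
    rintro ⟨a, x⟩ ⟨ha, -⟩
    show flowCircleAction ψ a x = ψ (σ a, x)
    conv_lhs => rw [← hright a ha]
    exact flowCircleAction_exp hper _ _
  exact (hsmooth.congr heq).contMDiffAt (hopen.mem_nhds ⟨ha₀, mem_univ _⟩)

/-- Each map `flowCircleAction ψ a` is `C^∞`. [folklore] -/
theorem contMDiff_flowCircleAction_apply (hψ : ContMDiff (𝓘(ℝ, ℝ).prod (𝓡 k)) (𝓡 k) ∞ ψ)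
    (a : Circle) : ContMDiff (𝓡 k) (𝓡 k) ∞ (flowCircleAction ψ a) :=
  hψ.comp (contMDiff_const.prodMk contMDiff_id)

end Smooth

end Literature.Geometry.Manifold
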